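import Summits.HodgeConjecture.HodgeConjecture.Theorems.H413FinCoeffNonvanishingAtSplitting
import Literature.NumberTheory.GelbartRogawski1991.UnitaryDualPairChiLineFinRepLocal
import Literature.NumberTheory.GelbartRogawski1991.UndoubledSplittingsUnitary
import Literature.NumberTheory.GelbartRogawski1991.UnitaryDualPairThetaKernelCM
import Literature.NumberTheory.GelbartRogawski1991.UnitaryDualPairThetaLiftGaussianCMLine
import Literature.NumberTheory.Automorphic.Liu2021.Def411WeilCarriersDoubling
import Literature.NumberTheory.Automorphic.UnitaryGroupPureTensorEulerProduct
import Literature.RepresentationTheory.HarrisKudlaSweet1996.GlobalSplittingCharacters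
import HarnessLib

/-!
# H413 ∕ S4b (FIN-PIN) — the `hfin` ROW AT THE CM LINE DATUM, ALL REFERENCE CHOICES DISCHARGED

Crux H413 (stmt-HodgeConjecture-24833), line `F0_P4AdmissibleOccursInH1`, stub S4b, row `hfin` of ★ brick 7
`thetaLift_charCM_tmul_ne_zero_of_finCoeff_ne_zero` at the pin.  ★ `exists_finCoeff_ne_zero_of_compatible`
(`H413FinCoeffNonvanishingAtSplitting`) gives the non-zero finite Fourier coefficient of `ω_f^{s}` for ANY compatible continuous
splitting `s` of a dual pair `(U(J_V), U(J₁))`, `J₁` a hermitian line, GIVEN a reference compatible splitting read on a unitary restricted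
family of local splittings (`sref`, `𝓢`, `hL2`, `href`), local Haar data normalised on `U(J₁)(𝒪_v)` off a finite set, and `[U(J₁)]` compact.
HERE all of these are DISCHARGED at the CM datum `(L⁺, L, c̄, diag dV, diag dW)` of a CM field `L` (`dV`, `dW` real and non-zero, `dW` a line,
`n = N·1 ≥ 3`):
* the reference splitting is the `χ`-attached splitting of the line ★ `chiSplittingLine` for a unitary splitting character `χ` of `L`, which
  EXISTS (★ `HarrisKudlaSweet1996.exists_isUnitary_isSplittingChar_one`) — so no character is a binder here; it is compatible and continuous
  (★ `isCompatible_chiSplittingLine`, ★ `continuous_chiSplittingLine`) and its finite Weil representation on the pair is the place-assembled `Ω`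
  of `congrW (undoubledSplittings (cmFinLocalFamily χ))` (★ `finPairRep_chiSplittingLine_apply`), unitary at every finite place
  (★ `isL2Isometric_omegaLoc_congrW_undoubledSplittings_cmFinLocalFamily`);
* `Tb = gram e (realDiagonal dV) (realDiagonal dW)` is invertible (★ `isUnit_det_gram`), `diag dW` is `c̄`-hermitian;
* the local Haar measures: `Measure.addHaar` on the Borel `L⁺_v`, and on `U(diag dW)(L⁺_v)` the Haar measure normalised on the compact open
  `U(diag dW)(𝒪_v)` (★ `isCompact_localInt`, ★ `isOpen_localInt`; σ-finite by ★ `locallyCompactSpace_localPi`, ★ `secondCountableTopology_localPi`),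
  `S₀` a singleton;
* `[U(diag dW)]` is compact (★ `compactSpace_quotient_range_toAdelic_line`).

* **`exists_finCoeff_ne_zero_cm`** — for every compatible continuous splitting `s` of the CM datum, every additive Haar `μ` on `(𝔸_{L⁺,f})ⁿ`,
  every Haar `μ_f` on `U(diag dW)(𝔸_{L⁺,f})` and every continuous unitary `χ_f : U(diag dW)(𝔸_{L⁺,f}) →* ℂˣ` there is `Φ_f ∈ 𝒮((𝔸_{L⁺,f})ⁿ)` with
  `∫ b, (∫ y, (R_e (ω_f^{s}(1,b) (R_e⁻¹ Φ_f))) y · conj (Φ_f y) ∂μ) · conj (χ_f b) ∂μ_f ≠ 0`;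
* **`exists_finCoeff_ne_zero_cm_splittingOf`** — the same at the CHOSEN splitting `splittingOf hGR` of a `CompatibleSplitting` witness
  (the pin: `e := e₁`, `dV := frameD V`, `dW := lineVec a`, `hGR := hGR₀`).

KERNEL: theorems only, DEF-FREE, no `sorry`.  HC_CM is proved only modulo the printed citations until rung 0 closes.

[cite: Li1992, Thm 2.1 (27) p. 184; §5 p. 206] [cite: GelbartRogawski1991, §3.1 Prop. 3.1.1 p. 455 and Remark p. 457 L4–13]
[cite: Liu2021, App. D §D.1 Steps 1–3 (l. 5214–5233)]
-/

set_option autoImplicit false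
set_option linter.dupNamespace false

noncomputable section

open scoped RestrictedProduct ENNReal NNReal ComplexConjugate Matrix Kronecker
open MeasureTheory NumberField IsDedekindDomain Filter Function Set Topology
open Literature.NumberTheory.Automorphic Literature.NumberTheory.Automorphic.UnitaryGroup
open Literature.NumberTheory.Weil1964
open Literature.NumberTheory.GelbartRogawski1991 Literature.NumberTheory.GelbartRogawski1991.UnitaryDualPair
open Literature.NumberTheory.GelbartRogawski1991.UnitaryDualPair.WeilCoinv
open Literature.NumberTheory.GelbartRogawski1991.GRConstruction
open Literature.NumberTheory.Automorphic.Liu2021.Def411WeilCarriersDoubling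
open Literature.RepresentationTheory.HarrisKudlaSweet1996

namespace Summit.HodgeConjecture.HodgeConjecture.Cruxes.H413.ThetaNonvanishing

section CMLine

variable (L : Type) [Field L] [NumberField L] [IsCMField L] {N n : ℕ} (e : Fin N × Fin 1 ≃ Fin n)
  (dV : Fin N → L) (hdV : ∀ i, IsCMField.complexConj L (dV i) = dV i) (hdV0 : ∀ i, dV i ≠ 0)
  (dW : Fin 1 → L) (hdW : ∀ i, IsCMField.complexConj L (dW i) = dW i) (hdW0 : ∀ i, dW i ≠ 0) (h3 : 3 ≤ n)

set_option maxHeartbeats 2000000 in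
-- heartbeats: the instantiation elaborates the `splittingDatum` telescope of ★ `exists_finCoeff_ne_zero_of_compatible` at the CM data
-- together with the `congrW (undoubledSplittings (cmFinLocalFamily …))` family (cf. ★ `finPairRep_chiSplittingLine_apply`, 1 600 000).
include hdV0 hdW0 h3 in
/-- **(FIN-PIN) the `hfin` row at the CM line datum, every reference choice discharged.**  For a CM field `L`, real non-zero `dV : Fin N → L`,
a real non-zero line `dW : Fin 1 → L`, `n = N·1 ≥ 3`, ANY compatible continuous splitting `s` of the CM dual pair `(U(diag dV), U(diag dW))`
(`cmSplittingDatum`), any additive Haar measure `μ` on `(𝔸_{L⁺,f})ⁿ`, any Haar measure `μ_f` on `U(diag dW)(𝔸_{L⁺,f})` and any continuous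
unitary character `χ_f` of `U(diag dW)(𝔸_{L⁺,f})`: there is `Φ_f ∈ 𝒮((𝔸_{L⁺,f})ⁿ)` with
`∫ b, (∫ y, (R_e (ω_f^{s}(1,b) (R_e⁻¹ Φ_f))) y · conj (Φ_f y) ∂μ) · conj (χ_f b) ∂μ_f ≠ 0` — ★ `exists_finCoeff_ne_zero_of_compatible` with
`sref := chiSplittingLine χ` for a unitary splitting character `χ` (★ `exists_isUnitary_isSplittingChar_one`), `href :=` ★
`finPairRep_chiSplittingLine_apply`, `hL2 :=` ★ `isL2Isometric_omegaLoc_congrW_undoubledSplittings_cmFinLocalFamily`, local Haar measures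
`Measure.addHaar` ∕ `haarMeasure U(diag dW)(𝒪_v)`, `[U(diag dW)]` compact (★ `compactSpace_quotient_range_toAdelic_line`).
[cite: Li1992, Thm 2.1 (27) p. 184; §5 p. 206] [cite: GelbartRogawski1991, §3.1 Prop. 3.1.1 p. 455, Remark p. 457 L4–13]
[cite: Liu2021, App. D §D.1 Steps 1–3 (l. 5214–5233)] -/
theorem exists_finCoeff_ne_zero_cm
    {s : UnitaryGroup.adelicPair (Fp L) L (IsCMField.complexConj L) N 1 (Matrix.diagonal dV) (Matrix.diagonal dW) →*
      adelicMpCont (Fp L) (Fin n) (adelicGram (Fp L) e (realDiagonal L dV hdV) (realDiagonal L dW hdW))}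
    (hs : (cmSplittingDatum L e dV hdV hdV0 dW hdW hdW0).IsCompatible s) (hsc : Continuous s)
    [MeasurableSpace (FiniteAdeleRing (𝓞 (Fp L)) (Fp L))] [BorelSpace (FiniteAdeleRing (𝓞 (Fp L)) (Fp L))]
    (μ : Measure (Fin n → FiniteAdeleRing (𝓞 (Fp L)) (Fp L))) [μ.IsAddHaarMeasure]
    [MeasurableSpace (UnitaryGroup.finAdelic (Fp L) L (IsCMField.complexConj L) 1 (Matrix.diagonal dW))]
    [BorelSpace (UnitaryGroup.finAdelic (Fp L) L (IsCMField.complexConj L) 1 (Matrix.diagonal dW))]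
    (μf : Measure (UnitaryGroup.finAdelic (Fp L) L (IsCMField.complexConj L) 1 (Matrix.diagonal dW))) [μf.IsHaarMeasure]
    (χf : UnitaryGroup.finAdelic (Fp L) L (IsCMField.complexConj L) 1 (Matrix.diagonal dW) →* ℂˣ)
    (hχf : Continuous fun b => ((χf b : ℂˣ) : ℂ)) (hχfu : ∀ b, ‖((χf b : ℂˣ) : ℂ)‖ = 1) :
    ∃ Φf : FinSB (Fp L) (Fin n),
      ∫ b, (∫ y, ((finSBReindex (Fp L) e (finPairRep (Fp L) L (IsCMField.complexConj L) N 1 e (Matrix.diagonal dV)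
              (Matrix.diagonal dW) (complexConj_imagUnit L) (imagUnit_ne_zero L) (imagUnit_mul_self L)
              (realDiagonal_isSymm L dV hdV) (realDiagonal_isSymm L dW hdW) (isUnit_det_realDiagonal L dV hdV hdV0)
              (isUnit_det_realDiagonal L dW hdW hdW0) (realDiagonal_map L dV hdV).symm (realDiagonal_map L dW hdW).symm hs (1, b)
              ((finSBReindex (Fp L) e).symm Φf)) : ↥(SchwartzBruhat (Fin n → FiniteAdeleRing (𝓞 (Fp L)) (Fp L)))) :
              (Fin n → FiniteAdeleRing (𝓞 (Fp L)) (Fp L)) → ℂ) y *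
          conj (((Φf : ↥(SchwartzBruhat (Fin n → FiniteAdeleRing (𝓞 (Fp L)) (Fp L)))) :
            (Fin n → FiniteAdeleRing (𝓞 (Fp L)) (Fp L)) → ℂ) y) ∂μ) *
        conj (((χf b : ℂˣ) : ℂ)) ∂μf ≠ 0 := by
  classical
  -- a unitary splitting character of `L` (the reference character; it does not appear in the statement)
  obtain ⟨χ, hχu, hχs⟩ := exists_isUnitary_isSplittingChar_one (L := L)
  -- Borel structures and additive Haar measures on the `L⁺_v`
  letI mF : ∀ v : HeightOneSpectrum (𝓞 (Fp L)), MeasurableSpace (v.adicCompletion (Fp L)) := fun v => borel _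
  haveI bF : ∀ v : HeightOneSpectrum (𝓞 (Fp L)), BorelSpace (v.adicCompletion (Fp L)) := fun v => ⟨rfl⟩
  -- Borel structures and Haar measures on the `U(diag dW)(L⁺_v)`, normalised on `U(diag dW)(𝒪_v)`
  haveI hlc : ∀ v : HeightOneSpectrum (𝓞 (Fp L)),
      LocallyCompactSpace (UnitaryGroup.localPi L (IsCMField.complexConj L) 1 (Matrix.diagonal dW) v) :=
    fun v => UnitaryGroup.locallyCompactSpace_localPi L 1 (IsCMField.complexConj L) (Matrix.diagonal dW) v
  haveI hsc2 : ∀ v : HeightOneSpectrum (𝓞 (Fp L)),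
      SecondCountableTopology (UnitaryGroup.localPi L (IsCMField.complexConj L) 1 (Matrix.diagonal dW) v) :=
    fun v => UnitaryGroup.secondCountableTopology_localPi L 1 (IsCMField.complexConj L) (Matrix.diagonal dW) v
  letI mP : ∀ v : HeightOneSpectrum (𝓞 (Fp L)),
      MeasurableSpace (UnitaryGroup.localPi L (IsCMField.complexConj L) 1 (Matrix.diagonal dW) v) := fun v => borel _
  haveI bP : ∀ v : HeightOneSpectrum (𝓞 (Fp L)),
      BorelSpace (UnitaryGroup.localPi L (IsCMField.complexConj L) 1 (Matrix.diagonal dW) v) := fun v => ⟨rfl⟩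
  have hKo : ∀ v : HeightOneSpectrum (𝓞 (Fp L)),
      IsOpen (UnitaryGroup.localInt L (IsCMField.complexConj L) 1 (Matrix.diagonal dW) v :
        Set (UnitaryGroup.localPi L (IsCMField.complexConj L) 1 (Matrix.diagonal dW) v)) :=
    fun v => isOpen_localInt L (IsCMField.complexConj L) 1 (Matrix.diagonal dW) v
  let C : ∀ v : HeightOneSpectrum (𝓞 (Fp L)),
      TopologicalSpace.PositiveCompacts (UnitaryGroup.localPi L (IsCMField.complexConj L) 1 (Matrix.diagonal dW) v) := fun v =>
    { carrier := (UnitaryGroup.localInt L (IsCMField.complexConj L) 1 (Matrix.diagonal dW) v :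
        Set (UnitaryGroup.localPi L (IsCMField.complexConj L) 1 (Matrix.diagonal dW) v))
      isCompact' := isCompact_localInt L (IsCMField.complexConj L) 1 (Matrix.diagonal dW) v
      interior_nonempty' := ⟨1, by rw [(hKo v).interior_eq]; exact one_mem _⟩ }
  let νW : ∀ v : HeightOneSpectrum (𝓞 (Fp L)),
      Measure (UnitaryGroup.localPi L (IsCMField.complexConj L) 1 (Matrix.diagonal dW) v) := fun v => Measure.haarMeasure (C v)
  haveI hνH : ∀ v, (νW v).IsHaarMeasure := fun v => Measure.isHaarMeasure_haarMeasure (C v)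
  haveI hνσ : ∀ v, SigmaFinite (νW v) := fun v => by
    haveI : SigmaCompactSpace (UnitaryGroup.localPi L (IsCMField.complexConj L) 1 (Matrix.diagonal dW) v) :=
      sigmaCompactSpace_of_locallyCompact_secondCountable
    infer_instance
  have hB1 : ∀ v : HeightOneSpectrum (𝓞 (Fp L)),
      νW v (UnitaryGroup.localInt L (IsCMField.complexConj L) 1 (Matrix.diagonal dW) v :
        Set (UnitaryGroup.localPi L (IsCMField.complexConj L) 1 (Matrix.diagonal dW) v)) = 1 :=
    fun v => Measure.haarMeasure_self
  -- a finite place `i₀` (the exceptional set is `{i₀}`)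
  obtain ⟨i₀⟩ : Nonempty (HeightOneSpectrum (𝓞 (Fp L))) := by
    obtain ⟨M, hM⟩ := Ideal.exists_maximal (𝓞 (Fp L))
    exact ⟨⟨M, hM.isPrime, Ring.ne_bot_of_isMaximal_of_not_isField hM (RingOfIntegers.not_isField (Fp L))⟩⟩
  -- `[U(diag dW)]` is compact (a real non-degenerate hermitian line is anisotropic)
  haveI := compactSpace_quotient_range_toAdelic_line L dW hdW hdW0
  -- `diag dW` is a `c̄`-hermitian line
  have hJ₁ : Matrix.diagonal dW 0 0 ≠ 0 := by
    rw [Matrix.diagonal_apply_eq]; exact hdW0 0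
  have hJ₁c : ((Matrix.diagonal dW).map (IsCMField.complexConj L))ᵀ = Matrix.diagonal dW := by
    rw [Matrix.diagonal_map (map_zero _), Matrix.diagonal_transpose]
    exact congrArg Matrix.diagonal (funext hdW)
  exact exists_finCoeff_ne_zero_of_compatible (Fp L) L (IsCMField.complexConj L) N e (Matrix.diagonal dV) (Matrix.diagonal dW) hJ₁
    (complexConj_imagUnit L) (imagUnit_ne_zero L) (imagUnit_mul_self L) _ _ _
    (congrW L e dV hdV (lineW L (realDiagonal L dW hdW)) (complexConj_lineW L (realDiagonal L dW hdW))
      (realDiagonal_lineW L (realDiagonal L dW hdW)) (diagonal_lineW L (realDiagonal L dW hdW) (realDiagonal_map L dW hdW).symm)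
      (undoubledSplittings L e dV hdV hdV0 (lineW L (realDiagonal L dW hdW)) (complexConj_lineW L (realDiagonal L dW hdW))
        (lineW_ne_zero L (realDiagonal L dW hdW) (isUnit_det_realDiagonal L dW hdW hdW0)) χ (borelPlaceMeasure L)
        (cmFinLocalFamily L e dV hdV hdV0 (lineW L (realDiagonal L dW hdW)) (complexConj_lineW L (realDiagonal L dW hdW))
          (lineW_ne_zero L (realDiagonal L dW hdW) (isUnit_det_realDiagonal L dW hdW hdW0)) χ hχs (borelPlaceMeasure L)))
      (realDiagonal_isSymm L dW hdW) (realDiagonal_map L dW hdW).symm)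
    (isUnit_det_gram (Fp L) e (isUnit_det_realDiagonal L dV hdV hdV0) (isUnit_det_realDiagonal L dW hdW hdW0)) h3 hJ₁c
    (fun _ => Measure.addHaar)
    (fun v => isL2Isometric_omegaLoc_congrW_undoubledSplittings_cmFinLocalFamily L e dV hdV hdV0
      (lineW L (realDiagonal L dW hdW)) (complexConj_lineW L (realDiagonal L dW hdW))
      (lineW_ne_zero L (realDiagonal L dW hdW) (isUnit_det_realDiagonal L dW hdW hdW0)) χ hχs (borelPlaceMeasure L) v hχu
      (realDiagonal_lineW L (realDiagonal L dW hdW)) (diagonal_lineW L (realDiagonal L dW hdW) (realDiagonal_map L dW hdW).symm)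
      (realDiagonal_isSymm L dW hdW) (realDiagonal_map L dW hdW).symm Measure.addHaar)
    μ μf νW {i₀} (Finset.mem_singleton_self i₀) (fun v _ => hB1 v)
    (realDiagonal_isSymm L dV hdV) (realDiagonal_isSymm L dW hdW) (isUnit_det_realDiagonal L dV hdV hdV0)
    (isUnit_det_realDiagonal L dW hdW hdW0) (realDiagonal_map L dV hdV).symm (realDiagonal_map L dW hdW).symm hs
    (isCompatible_chiSplittingLine L e dV hdV hdV0 χ hχu hχs (realDiagonal L dW hdW) (realDiagonal_isSymm L dW hdW)
      (isUnit_det_realDiagonal L dW hdW hdW0) (Matrix.diagonal dW) (realDiagonal_map L dW hdW).symm)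
    hsc
    (continuous_chiSplittingLine L e dV hdV hdV0 χ hχu hχs (realDiagonal L dW hdW) (isUnit_det_realDiagonal L dW hdW hdW0)
      (Matrix.diagonal dW) (realDiagonal_map L dW hdW).symm)
    (fun b f => finPairRep_chiSplittingLine_apply L e dV hdV hdV0 χ hχu hχs (realDiagonal L dW hdW) (realDiagonal_isSymm L dW hdW)
      (isUnit_det_realDiagonal L dW hdW hdW0) (Matrix.diagonal dW) (realDiagonal_map L dW hdW).symm (1, b) f)
    χf hχf hχfu

set_option maxHeartbeats 800000 in
-- heartbeats: the statement carries the CM `splittingDatum` telescope twice (`splittingOf`, `splittingOf_isCompatible`).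
include hdV0 hdW0 h3 in
/-- **(FIN-PIN) at the CHOSEN splitting `splittingOf hGR`** of a `CompatibleSplitting` witness of the CM datum (the pin: `e := e₁`,
`dV := frameD V`, `dW := lineVec a`, `hGR := hGR₀`, `n = 3`): for every additive Haar `μ` on `(𝔸_{L⁺,f})ⁿ`, every Haar `μ_f` on
`U(diag dW)(𝔸_{L⁺,f})` and every continuous unitary `χ_f`, some `Φ_f ∈ 𝒮((𝔸_{L⁺,f})ⁿ)` has
`∫ b, (∫ y, (R_e (ω_f^{splittingOf hGR}(1,b) (R_e⁻¹ Φ_f))) y · conj (Φ_f y) ∂μ) · conj (χ_f b) ∂μ_f ≠ 0`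
(`exists_finCoeff_ne_zero_cm` at `hs := splittingOf_isCompatible hGR`, `hsc := continuous_splittingOf hGR`).
[cite: Li1992, Thm 2.1 (27) p. 184; §5 p. 206] [cite: GelbartRogawski1991, §3.1 Prop. 3.1.1 p. 455, Remark p. 457 L4–13] -/
theorem exists_finCoeff_ne_zero_cm_splittingOf (hGR : (cmSplittingDatum L e dV hdV hdV0 dW hdW hdW0).CompatibleSplitting)
    [MeasurableSpace (FiniteAdeleRing (𝓞 (Fp L)) (Fp L))] [BorelSpace (FiniteAdeleRing (𝓞 (Fp L)) (Fp L))]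
    (μ : Measure (Fin n → FiniteAdeleRing (𝓞 (Fp L)) (Fp L))) [μ.IsAddHaarMeasure]
    [MeasurableSpace (UnitaryGroup.finAdelic (Fp L) L (IsCMField.complexConj L) 1 (Matrix.diagonal dW))]
    [BorelSpace (UnitaryGroup.finAdelic (Fp L) L (IsCMField.complexConj L) 1 (Matrix.diagonal dW))]
    (μf : Measure (UnitaryGroup.finAdelic (Fp L) L (IsCMField.complexConj L) 1 (Matrix.diagonal dW))) [μf.IsHaarMeasure]
    (χf : UnitaryGroup.finAdelic (Fp L) L (IsCMField.complexConj L) 1 (Matrix.diagonal dW) →* ℂˣ)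
    (hχf : Continuous fun b => ((χf b : ℂˣ) : ℂ)) (hχfu : ∀ b, ‖((χf b : ℂˣ) : ℂ)‖ = 1) :
    ∃ Φf : FinSB (Fp L) (Fin n),
      ∫ b, (∫ y, ((finSBReindex (Fp L) e (finPairRep (Fp L) L (IsCMField.complexConj L) N 1 e (Matrix.diagonal dV)
              (Matrix.diagonal dW) (complexConj_imagUnit L) (imagUnit_ne_zero L) (imagUnit_mul_self L)
              (realDiagonal_isSymm L dV hdV) (realDiagonal_isSymm L dW hdW) (isUnit_det_realDiagonal L dV hdV hdV0)
              (isUnit_det_realDiagonal L dW hdW hdW0) (realDiagonal_map L dV hdV).symm (realDiagonal_map L dW hdW).symm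
              (splittingOf_isCompatible (Fp L) L (IsCMField.complexConj L) N 1 e (Matrix.diagonal dV) (Matrix.diagonal dW)
                (complexConj_imagUnit L) (imagUnit_ne_zero L) (imagUnit_mul_self L) (realDiagonal_isSymm L dV hdV)
                (realDiagonal_isSymm L dW hdW) (isUnit_det_realDiagonal L dV hdV hdV0) (isUnit_det_realDiagonal L dW hdW hdW0)
                (realDiagonal_map L dV hdV).symm (realDiagonal_map L dW hdW).symm hGR)
              (1, b) ((finSBReindex (Fp L) e).symm Φf)) : ↥(SchwartzBruhat (Fin n → FiniteAdeleRing (𝓞 (Fp L)) (Fp L)))) :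
              (Fin n → FiniteAdeleRing (𝓞 (Fp L)) (Fp L)) → ℂ) y *
          conj (((Φf : ↥(SchwartzBruhat (Fin n → FiniteAdeleRing (𝓞 (Fp L)) (Fp L)))) :
            (Fin n → FiniteAdeleRing (𝓞 (Fp L)) (Fp L)) → ℂ) y) ∂μ) *
        conj (((χf b : ℂˣ) : ℂ)) ∂μf ≠ 0 :=
  exists_finCoeff_ne_zero_cm L e dV hdV hdV0 dW hdW hdW0 h3
    (splittingOf_isCompatible (Fp L) L (IsCMField.complexConj L) N 1 e (Matrix.diagonal dV) (Matrix.diagonal dW)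
      (complexConj_imagUnit L) (imagUnit_ne_zero L) (imagUnit_mul_self L) (realDiagonal_isSymm L dV hdV)
      (realDiagonal_isSymm L dW hdW) (isUnit_det_realDiagonal L dV hdV hdV0) (isUnit_det_realDiagonal L dW hdW hdW0)
      (realDiagonal_map L dV hdV).symm (realDiagonal_map L dW hdW).symm hGR)
    (continuous_splittingOf (Fp L) L (IsCMField.complexConj L) N 1 e (Matrix.diagonal dV) (Matrix.diagonal dW)
      (complexConj_imagUnit L) (imagUnit_ne_zero L) (imagUnit_mul_self L) (realDiagonal_isSymm L dV hdV)
      (realDiagonal_isSymm L dW hdW) (isUnit_det_realDiagonal L dV hdV hdV0) (isUnit_det_realDiagonal L dW hdW hdW0)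
      (realDiagonal_map L dV hdV).symm (realDiagonal_map L dW hdW).symm hGR)
    μ μf χf hχf hχfu

end CMLine

end Summit.HodgeConjecture.HodgeConjecture.Cruxes.H413.ThetaNonvanishing

end
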